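import Summits.MatrixMultiplication.OmegaCensus.STPPSmallPatternT1PackingBound
import Summits.MatrixMultiplication.OmegaCensus.STPPSmallPatternT2PackingBound
import Summits.MatrixMultiplication.OmegaCensus.STPPSmallPatternCriteria
import Literature.Combinatorics.Additive.Kneser
import Summits.MatrixMultiplication.OmegaCensus.STPPKneserFilter

/-!
# ω-census, small patterns: the N9 packing laws are NEVER tight beyond the base cases — `4k ≤ |H| + 1` (`k ≥ 5`), `6k ≤ |H| + 1` (`k ≥ 3`), by Kneser

Cell `pub-omega`, ω construction census, seat pub-omega ENG2 (gen 33). HONEST FRAMING (verbatim): lottery ticket; floor =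
certified bounds/negative ranges.  Census STRUCTURE bookkeeping for column B5 (the lower laws of `T1(H)` / `T2(H)` over all finite
abelian `H`); nothing here bears on `ω`.

The tree's linear laws (`four_mul_le_card_add_two_of_isSTPP_211`: `(2,1,1)^k ⊆ H ⇒ 4k ≤ |H| + 2`; `six_mul_le_card_add_two_of_isSTPP_122`:
`(1,2,2)^k ⊆ H ⇒ 6k ≤ |H| + 2`; both the filter N9) are tight at `k ≤ 2` resp. `k = 1` (`ℤ/2 ⊇ (2,1,1)¹`, `ℤ/6 ⊇ (2,1,1)²`, `ℤ/4 ⊇ (1,2,2)¹`).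
This file shows with KNESER'S ADDITION THEOREM (tree `Literature.Combinatorics.Additive.Kneser`, weak form
`#s + #t ≤ #(s+t) + #Stab(s+t)`, `#Stab ∣ #s+t`-type divisibilities) that the EQUALITY CASE of N9 is impossible from `k = 5` resp. `k = 3` on:

* `(2,1,1)`, difference model `Aᵢ = {pᵢ,qᵢ}` (disjoint pairs), `Bᵢ = {0}`, `Cᵢ = {cᵢ}` (`exists_isSTPP_211_iff`).  `X = ⊔ᵢ (Aᵢ − cᵢ)` has `2k`
  elements and is disjoint from each `Wⱼ = (A ∖ Aⱼ) − cⱼ` (`2k − 2` elements).  If `|H| = 4k − 2` then `Wⱼ = H ∖ X =: W` for EVERY `j`, so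
  `C + W = ⋃ⱼ (A ∖ Aⱼ) = A`: a sumset with `|C| = k`, `|W| = 2k − 2`, `|C + W| = 2k`.  Kneser: the stabiliser `K` of `A` has
  `|K| ≥ k − 2`; but `|K|` divides `|A| = 2k` and `|H| = 4k − 2`, hence divides `2` — impossible for `k ≥ 5`.
  **`four_mul_le_card_add_one_of_isSTPP_211`: `(2,1,1)^k ⊆ H`, `k ≥ 5` ⇒ `4k ≤ |H| + 1`.**
* `(1,2,2)`, model `Aᵢ = {0}`, pairs `Bᵢ`, `Cᵢ` (`exists_isSTPP_122_iff`).  `Y = ⊔ⱼ (Cⱼ − Bⱼ)` (`4k` elements, tree `STPPKneser.card_DU_BC`) is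
  disjoint from each `u − (B ∖ B_l)` (`u ∈ C_l`; `2k − 2` elements).  If `|H| = 6k − 2` all these equal `V = H ∖ Y`, so `C − V = B`:
  `|C| = 2k`, `|V| = 2k − 2`, `|C − V| = 2k`; Kneser gives `|Stab B| ≥ 2k − 2`, and `|Stab B| ∣ 2k` forces `Stab B` of order `2k` (`k ≥ 3`),
  which does not divide `|H| = 6k − 2`.  **`six_mul_le_card_add_one_of_isSTPP_122`: `(1,2,2)^k ⊆ H`, `k ≥ 3` ⇒ `6k ≤ |H| + 1`.**

Census reading: `onset_T1(k) ≥ 4k − 1` (`k ≥ 5`; data `24, 30, 38, 48, …` for `k = 5, 6, 7, 8`), `onset_T2(k) ≥ 6k − 1` (`k ≥ 3`; data `24, 32, 48`) —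
`+1` over N9, the first lower law on the thin columns that is not a packing count.  No further sharpness claimed.

References: M. Kneser, Math. Z. 58 (1953) 459–484 (via the tree's `Kneser.lean`); H. Cohn, R. Kleinberg, B. Szegedy, C. Umans, FOCS 2005
(arXiv:math/0511460), Def. 5.1.  Seat pub-omega ENG2 (gen 33), 2026-08-28.
-/

open Literature.Computability.AlgebraicComplexity Finset
open scoped Pointwise

namespace Summit.MatrixMultiplication.OmegaCensus

variable {H : Type*} [AddCommGroup H] [Fintype H] [DecidableEq H]

/-! ## Pattern `(2,1,1)` -/

/-- **`(2,1,1)^k ⊆ H` with `k ≥ 5` forces `4k ≤ |H| + 1`** (the equality case `|H| = 4k − 2` of the N9 law is impossible, by Kneser's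
theorem applied to `C + W = A`; see the module docstring). [cite: CohnKleinbergSzegedyUmans2005, Def. 5.1] -/
theorem four_mul_le_card_add_one_of_isSTPP_211 {k : ℕ} (hk : 5 ≤ k)
    (h : ∃ A B C : Fin k → Finset H, IsSTPP A B C ∧ ∀ i, (A i).card = 2 ∧ (B i).card = 1 ∧ (C i).card = 1) :
    4 * k ≤ Fintype.card H + 1 := by
  have h2 := four_mul_le_card_add_two_of_isSTPP_211 h
  by_contra hlt
  have hcard : Fintype.card H + 2 = 4 * k := by omega
  obtain ⟨p, q, c, hpq, hD, hX⟩ := exists_isSTPP_211_iff.1 h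
  have k0 : 0 < k := by omega
  -- the pairs, their union `A`, the points `C`
  set P : Fin k → Finset H := fun i => ({p i, q i} : Finset H) with hP
  have hPcard : ∀ i, (P i).card = 2 := fun i => card_pair (hpq i)
  set A : Finset H := univ.biUnion P with hA
  have hAcard : A.card = 2 * k := by
    rw [hA, card_biUnion (fun i _ j _ hij => hD i j hij), sum_congr rfl (fun i _ => hPcard i), sum_const, card_univ,
      Fintype.card_fin, smul_eq_mul, mul_comm]
  have hmemA : ∀ {x}, x ∈ A ↔ ∃ i, x ∈ P i := by
    intro x; simp [hA]
  have hc_inj : Function.Injective c := by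
    intro j l hjl
    by_contra hne
    exact hX l j l hne (p l) (by simp) (p l) (by simp) (by rw [sub_self, hjl, sub_self])
  set Cs : Finset H := univ.image c with hCs
  have hCcard : Cs.card = k := by rw [hCs, card_image_of_injective _ hc_inj, card_univ, Fintype.card_fin]
  -- `X = ⊔ (Pᵢ − cᵢ)`
  set X : Finset H := univ.biUnion fun i => (P i).image (fun x => x - c i) with hXdef
  have hXcard : X.card = 2 * k := by
    rw [hXdef, card_biUnion]
    · rw [sum_congr rfl (fun i _ => by rw [card_image_of_injective _ (sub_left_injective), hPcard i]), sum_const, card_univ,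
        Fintype.card_fin, smul_eq_mul, mul_comm]
    · intro i _ l _ hil
      rw [Function.onFun, disjoint_left]
      intro z hzi hzl
      rw [mem_image] at hzi hzl
      obtain ⟨x, hx, rfl⟩ := hzi
      obtain ⟨y, hy, hxy⟩ := hzl
      exact hX i i l hil x hx y hy (by rw [show x - y = (x - c i) - (y - c l) + (c i - c l) by abel, hxy, sub_self, zero_add])
  -- `W j = (A \ P j) − c j`, disjoint from `X`, of size `2k − 2`
  set W : Fin k → Finset H := fun j => (A \ P j).image (fun y => y - c j) with hWdef
  have hWcard : ∀ j, (W j).card = 2 * k - 2 := by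
    intro j
    rw [hWdef]; dsimp only
    rw [card_image_of_injective _ (sub_left_injective), card_sdiff_of_subset (subset_biUnion_of_mem P (mem_univ j)), hAcard, hPcard]
  have hXW : ∀ j, Disjoint X (W j) := by
    intro j
    rw [disjoint_left]
    intro z hzX hzW
    rw [hXdef, mem_biUnion] at hzX
    obtain ⟨i, -, hzi⟩ := hzX
    rw [mem_image] at hzi
    obtain ⟨x, hx, rfl⟩ := hzi
    rw [hWdef] at hzW; dsimp only at hzW
    rw [mem_image] at hzW
    obtain ⟨y, hy, hxy⟩ := hzW
    rw [mem_sdiff] at hy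
    obtain ⟨hyA, hyj⟩ := hy
    obtain ⟨i', hyi'⟩ := hmemA.1 hyA
    by_cases hji : j = i
    · subst hji
      have : y = x := sub_left_injective hxy
      subst this
      exact hyj hx
    · exact hX i' j i hji y hyi' x hx (by rw [show y - x = (y - c j) - (x - c i) + (c j - c i) by abel, hxy, sub_self, zero_add])
  -- equality case: `W j = univ \ X` for all `j`
  have hWeq : ∀ j, W j = univ \ X := by
    intro j
    apply eq_of_subset_of_card_le
    · intro z hz
      rw [mem_sdiff]
      exact ⟨mem_univ _, fun hzX => disjoint_left.1 (hXW j) hzX hz⟩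
    · rw [card_sdiff_of_subset (subset_univ _), card_univ, hXcard, hWcard]
      omega
  set V : Finset H := univ \ X with hV
  have hVcard : V.card = 2 * k - 2 := by rw [← hWeq ⟨0, k0⟩, hWcard]
  -- `Cs + V = A`
  have hsum : Cs + V = A := by
    ext z
    rw [mem_add]
    constructor
    · rintro ⟨u, hu, v, hv, rfl⟩
      rw [hCs, mem_image] at hu
      obtain ⟨j, -, rfl⟩ := hu
      rw [← hWeq j, hWdef] at hv; dsimp only at hv
      rw [mem_image] at hv
      obtain ⟨y, hy, rfl⟩ := hv
      rw [add_sub_cancel]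
      exact (mem_sdiff.1 hy).1
    · intro hz
      obtain ⟨i, hzi⟩ := hmemA.1 hz
      -- pick `j ≠ i`
      obtain ⟨j, hji⟩ : ∃ j : Fin k, j ≠ i := by
        by_cases hi : i = ⟨0, k0⟩
        · exact ⟨⟨1, by omega⟩, fun h => by rw [hi] at h; exact absurd (congrArg Fin.val h) (by simp)⟩
        · exact ⟨⟨0, k0⟩, fun h => hi h.symm⟩
      refine ⟨c j, by rw [hCs]; exact mem_image_of_mem _ (mem_univ _), z - c j, ?_, by abel⟩
      rw [← hWeq j, hWdef]; dsimp only
      refine mem_image_of_mem _ (mem_sdiff.2 ⟨hz, fun hzj => ?_⟩)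
      exact disjoint_left.1 (hD j i hji) hzj hzi
  -- Kneser
  have hCne : Cs.Nonempty := ⟨c ⟨0, k0⟩, by rw [hCs]; exact mem_image_of_mem _ (mem_univ _)⟩
  have hVne : V.Nonempty := by rw [← card_pos, hVcard]; omega
  obtain ⟨hkn, hdvdH⟩ := Literature.Combinatorics.Additive.card_add_card_le_card_add_add_card_addStab_and_dvd Cs V hCne hVne
  rw [hsum, hCcard, hVcard, hAcard] at hkn
  rw [hsum] at hdvdH
  have hdvdA : #(A.addStab) ∣ 2 * k := by rw [← hAcard]; exact Finset.card_addStab_dvd_card A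
  have hdvd2 : #(A.addStab) ∣ 2 := by
    have h1 : #(A.addStab) ∣ 2 * (2 * k) := Dvd.dvd.mul_left hdvdA 2
    have h2 : #(A.addStab) ∣ Fintype.card H := hdvdH
    have : 2 = 2 * (2 * k) - Fintype.card H := by omega
    rw [this]
    exact Nat.dvd_sub h1 h2
  have hle : #(A.addStab) ≤ 2 := Nat.le_of_dvd (by norm_num) hdvd2
  omega

/-- `Nat.card` form: `(2,1,1)^k ⊆ H`, `k ≥ 5` ⇒ `4k ≤ |H| + 1`. [cite: CohnKleinbergSzegedyUmans2005, Def. 5.1] -/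
theorem four_mul_le_natCard_add_one_of_isSTPP_211 {G : Type*} [AddCommGroup G] [Finite G] {k : ℕ} (hk : 5 ≤ k)
    (h : ∃ A B C : Fin k → Finset G, IsSTPP A B C ∧ ∀ i, (A i).card = 2 ∧ (B i).card = 1 ∧ (C i).card = 1) :
    4 * k ≤ Nat.card G + 1 := by
  classical
  cases nonempty_fintype G
  rw [Nat.card_eq_fintype_card]; exact four_mul_le_card_add_one_of_isSTPP_211 hk h

/-- Contrapositive: **no finite abelian group of order `≤ 4k − 2` hosts `(2,1,1)^k` when `k ≥ 5`.** [cite: CohnKleinbergSzegedyUmans2005, Def. 5.1] -/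
theorem not_exists_isSTPP_211_of_card_add_one_lt {G : Type*} [AddCommGroup G] [Finite G] {k : ℕ} (hk : 5 ≤ k)
    (hG : Nat.card G + 1 < 4 * k) :
    ¬ ∃ A B C : Fin k → Finset G, IsSTPP A B C ∧ ∀ i, (A i).card = 2 ∧ (B i).card = 1 ∧ (C i).card = 1 :=
  fun h => absurd (four_mul_le_natCard_add_one_of_isSTPP_211 hk h) (by omega)

/-! ## Pattern `(1,2,2)` -/

/-- **`(1,2,2)^k ⊆ H` with `k ≥ 3` forces `6k ≤ |H| + 1`** (the equality case `|H| = 6k − 2` of the N9 law is impossible: Kneser on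
`C − V = B` makes `B` a coset of a subgroup of order `2k`, which cannot divide `6k − 2`). [cite: CohnKleinbergSzegedyUmans2005, Def. 5.1] -/
theorem six_mul_le_card_add_one_of_isSTPP_122 {k : ℕ} (hk : 3 ≤ k)
    (h : ∃ A B C : Fin k → Finset H, IsSTPP A B C ∧ ∀ i, (A i).card = 1 ∧ (B i).card = 2 ∧ (C i).card = 2) :
    6 * k ≤ Fintype.card H + 1 := by
  have h2 := six_mul_le_card_add_two_of_isSTPP_122 h
  by_contra hlt
  have hcard : Fintype.card H + 2 = 6 * k := by omega
  obtain ⟨b, b', c, c', hb, hc, hU, hX⟩ := exists_isSTPP_122_iff.1 h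
  have k0 : 0 < k := by omega
  set PB : Fin k → Finset H := fun i => ({b i, b' i} : Finset H) with hPB
  set PC : Fin k → Finset H := fun i => ({c i, c' i} : Finset H) with hPC
  have hS' : IsSTPP (fun _ : Fin k => ({0} : Finset H)) PB PC := (isSTPP_pointPairs_iff b b' c c').2 ⟨hU, hX⟩
  have hPBcard : ∀ i, (PB i).card = 2 := fun i => card_pair (hb i)
  have hPCcard : ∀ i, (PC i).card = 2 := fun i => card_pair (hc i)
  -- the `B`-pairs and the `C`-pairs are pairwise disjoint
  have hDB : ∀ i j, i ≠ j → Disjoint (PB i) (PB j) := by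
    intro i j hij
    rw [disjoint_left]
    intro t hti htj
    exact hX i j j (Or.inl hij) t hti t htj (c j) (by simp) (c j) (by simp) rfl
  have hDC : ∀ j l, j ≠ l → Disjoint (PC j) (PC l) := by
    intro j l hjl
    rw [disjoint_left]
    intro u huj hul
    exact hX j j l (Or.inr (Ne.symm hjl)) (b j) (by simp) (b j) (by simp) u huj u hul rfl
  set Bs : Finset H := univ.biUnion PB with hBs
  have hBcard : Bs.card = 2 * k := by
    rw [hBs, card_biUnion (fun i _ j _ hij => hDB i j hij), sum_congr rfl (fun i _ => hPBcard i), sum_const, card_univ,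
      Fintype.card_fin, smul_eq_mul, mul_comm]
  have hmemB : ∀ {x}, x ∈ Bs ↔ ∃ i, x ∈ PB i := by
    intro x; simp [hBs]
  set Cs : Finset H := univ.biUnion PC with hCs
  have hCcard : Cs.card = 2 * k := by
    rw [hCs, card_biUnion (fun i _ j _ hij => hDC i j hij), sum_congr rfl (fun i _ => hPCcard i), sum_const, card_univ,
      Fintype.card_fin, smul_eq_mul, mul_comm]
  have hmemC : ∀ {x}, x ∈ Cs ↔ ∃ i, x ∈ PC i := by
    intro x; simp [hCs]
  -- `Y = ⊔ (C_j − B_j)`, `4k` elements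
  set Y : Finset H := STPPKneser.DU PB PC univ with hY
  have hYcard : Y.card = 4 * k := by
    rw [hY, STPPKneser.card_DU_BC hS' (fun _ => ⟨0, mem_singleton_self _⟩) univ,
      sum_congr rfl (fun i _ => by rw [hPBcard i, hPCcard i]), sum_const, card_univ, Fintype.card_fin, smul_eq_mul]
    ring
  -- the free translates `u − (B \ B_l)`, `u ∈ C_l`
  have hWcard : ∀ l (u : H), ((Bs \ PB l).image (fun t => u - t)).card = 2 * k - 2 := by
    intro l u
    rw [card_image_of_injective _ (sub_right_injective), card_sdiff_of_subset (subset_biUnion_of_mem PB (mem_univ l)),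
      hBcard, hPBcard]
  have hYW : ∀ l, ∀ u ∈ PC l, Disjoint Y ((Bs \ PB l).image (fun t => u - t)) := by
    intro l u hu
    rw [disjoint_left]
    intro z hzY hzW
    rw [hY, STPPKneser.DU, mem_biUnion] at hzY
    obtain ⟨j, -, hzj⟩ := hzY
    rw [STPPKneser.mem_D] at hzj
    obtain ⟨e, he, f, hf, rfl⟩ := hzj
    rw [mem_image] at hzW
    obtain ⟨t, ht, hft⟩ := hzW
    rw [mem_sdiff] at ht
    obtain ⟨htB, htl⟩ := ht
    obtain ⟨i, hti⟩ := hmemB.1 htB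
    have hil : i ≠ l := fun hh => htl (hh ▸ hti)
    have hor : i ≠ j ∨ l ≠ j := by
      rcases eq_or_ne i j with hij | hij
      · exact Or.inr fun hlj => hil (hij.trans hlj.symm)
      · exact Or.inl hij
    exact hX i j l hor t hti e he f hf u hu (by rw [← neg_sub f e, ← hft, neg_sub])
  -- equality case: every free translate is `univ \ Y`
  have hWeq : ∀ l, ∀ u ∈ PC l, (Bs \ PB l).image (fun t => u - t) = univ \ Y := by
    intro l u hu
    apply eq_of_subset_of_card_le
    · intro z hz
      rw [mem_sdiff]
      exact ⟨mem_univ _, fun hzY => disjoint_left.1 (hYW l u hu) hzY hz⟩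
    · rw [card_sdiff_of_subset (subset_univ _), card_univ, hYcard, hWcard]
      omega
  set V : Finset H := univ \ Y with hV
  have hVcard : V.card = 2 * k - 2 := by rw [← hWeq ⟨0, k0⟩ (c ⟨0, k0⟩) (by simp [hPC]), hWcard]
  -- `Cs − V = Bs`
  have hsub : Cs - V = Bs := by
    ext z
    rw [mem_sub]
    constructor
    · rintro ⟨u, hu, v, hv, rfl⟩
      obtain ⟨l, hul⟩ := hmemC.1 hu
      rw [← hWeq l u hul, mem_image] at hv
      obtain ⟨t, ht, rfl⟩ := hv
      rw [sub_sub_cancel]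
      exact (mem_sdiff.1 ht).1
    · intro hz
      obtain ⟨i, hzi⟩ := hmemB.1 hz
      obtain ⟨l, hli⟩ : ∃ l : Fin k, l ≠ i := by
        by_cases hi : i = ⟨0, k0⟩
        · exact ⟨⟨1, by omega⟩, fun hh => by rw [hi] at hh; exact absurd (congrArg Fin.val hh) (by simp)⟩
        · exact ⟨⟨0, k0⟩, fun hh => hi hh.symm⟩
      refine ⟨c l, hmemC.2 ⟨l, by simp [hPC]⟩, c l - z, ?_, by rw [sub_sub_cancel]⟩
      rw [← hWeq l (c l) (by simp [hPC])]
      exact mem_image_of_mem _ (mem_sdiff.2 ⟨hz, fun hzl => disjoint_left.1 (hDB l i hli) hzl hzi⟩)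
  -- Kneser on `Cs + (−V)`
  have hCne : Cs.Nonempty := by rw [← card_pos, hCcard]; omega
  have hVne : (-V).Nonempty := by rw [← card_pos, card_neg, hVcard]; omega
  obtain ⟨hkn, hdvdH⟩ := Literature.Combinatorics.Additive.card_add_card_le_card_add_add_card_addStab_and_dvd Cs (-V) hCne hVne
  rw [← sub_eq_add_neg, hsub, hCcard, card_neg, hVcard, hBcard] at hkn
  rw [← sub_eq_add_neg, hsub] at hdvdH
  have hdvdB : #(Bs.addStab) ∣ 2 * k := by rw [← hBcard]; exact Finset.card_addStab_dvd_card Bs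
  have hK : #(Bs.addStab) = 2 * k := by
    obtain ⟨d, hd⟩ := hdvdB
    rcases Nat.lt_or_ge d 2 with hd2 | hd2
    · interval_cases d
      · omega
      · rw [hd, mul_one]
    · have := Nat.mul_le_mul_left (#(Bs.addStab)) hd2
      rw [← hd] at this
      omega
  rw [hK] at hdvdH
  have h6 : 2 * k ∣ 3 * (2 * k) - Fintype.card H := Nat.dvd_sub (dvd_mul_left _ _) hdvdH
  rw [show 3 * (2 * k) - Fintype.card H = 2 by omega] at h6
  have := Nat.le_of_dvd two_pos h6
  omega

/-- `Nat.card` form: `(1,2,2)^k ⊆ H`, `k ≥ 3` ⇒ `6k ≤ |H| + 1`. [cite: CohnKleinbergSzegedyUmans2005, Def. 5.1] -/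
theorem six_mul_le_natCard_add_one_of_isSTPP_122 {G : Type*} [AddCommGroup G] [Finite G] {k : ℕ} (hk : 3 ≤ k)
    (h : ∃ A B C : Fin k → Finset G, IsSTPP A B C ∧ ∀ i, (A i).card = 1 ∧ (B i).card = 2 ∧ (C i).card = 2) :
    6 * k ≤ Nat.card G + 1 := by
  classical
  cases nonempty_fintype G
  rw [Nat.card_eq_fintype_card]; exact six_mul_le_card_add_one_of_isSTPP_122 hk h

/-- Contrapositive: **no finite abelian group of order `≤ 6k − 2` hosts `(1,2,2)^k` when `k ≥ 3`.** [cite: CohnKleinbergSzegedyUmans2005, Def. 5.1] -/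
theorem not_exists_isSTPP_122_of_card_add_one_lt {G : Type*} [AddCommGroup G] [Finite G] {k : ℕ} (hk : 3 ≤ k)
    (hG : Nat.card G + 1 < 6 * k) :
    ¬ ∃ A B C : Fin k → Finset G, IsSTPP A B C ∧ ∀ i, (A i).card = 1 ∧ (B i).card = 2 ∧ (C i).card = 2 :=
  fun h => absurd (six_mul_le_natCard_add_one_of_isSTPP_122 hk h) (by omega)

end Summit.MatrixMultiplication.OmegaCensus
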